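import Summits.QuantumFields.YangMills.Theorems.AtomicCalibrationRLevelConstants
import Summits.QuantumFields.YangMills.Theorems.AtomicCalibrationRGevreyLevelMass
import Summits.QuantumFields.YangMills.Theorems.AtomicCalibrationRGevreyFarLevelMass
import Summits.QuantumFields.YangMills.Theorems.AtomicCalibrationRGevreyBandBump
import Summits.QuantumFields.YangMills.Theorems.AtomicCalibrationRTelescopingAssembly

/-!
# AtomicCalibrationR (stmt-QuantumFields-28169), E2 `stub_offDiagonalWhitney` — the Whitney weights of every level, uniformly in the level
# (roadmap v2 items B.3/B.4: total mass; prover w4 g23, free hands)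

Construction (T) at separation ratio `Λ ≥ 1`, derivative budget `N'·n`: level `k` consists of the pieces
`P_{k,c} = G · tele(pairCut n · ) k · gridBump φ n h_k c`, `c : Fin n × Fin 4 → ℤ`, with `tele χ 0 = χ 0` (far level, all slot pairs
`> 1` apart) and `tele χ (k+1) = χ (k+1) − χ k` (band level, pairs `> 2^{−(k+1)}`), mesh `h_k = 2^{−k}/(8(Λ+1))`, radius `ρ_k = 2h_k`,
`G ∈ {Re F, Im F}`.  Given GEVREY bounds for the profile `φ` and for the step `PairCutoff.stepψ` (exponent `s`), this file proves the
`k`-UNIFORM level statement behind clauses (v)–(vi) of `WhitneyPkg`: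

* `level_weights` — there are `α, C, γ` (depending only on `Λ, N', s` and the Gevrey constants) such that for every `n ≥ 1`, every
  off-diagonal `F`, every dominated real `C^∞` factor `G` and EVERY level `k` there are weights `M ≥ 0` on the cubes with
  `Summable M`, `Σ' M ≤ α Cⁿ (n!)^γ · 2^{−k} · ‖F‖_{(N'+6)n}` and `‖D^m P_{k,c}(z)‖ ≤ M c / ρ_k^m` for all `m ≤ N'n`, all `z`.

It is `GevreyFarLevelMass.far_level_mass_factorial` (level `0`) and `GevreyLevelMass.level_mass_factorial` (levels `k+1`, `n ≥ 2`;
for `n = 1` the band pieces vanish) fed with the budget-free rates of `GevreyBandBump` (`cut stepψ = pairCut`; `‖φ‖ ≤ 1` as in `BandBump.profile_abs_le_one`), made uniform in `k`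
and admissible in `n` by `LevelConstants`.  No definitions; no stub/crux/rung/summit is closed; nothing here touches Yang–Mills; the YM
mass gap is NOT proved. [folklore]
-/

set_option autoImplicit false

noncomputable section

open scoped BigOperators ContDiff
open Set
open Summit.QuantumFields.YangMills.Cruxes.AtomicCalibrationR.PairCutoff (pairCut stepψ contDiff_stepψ stepψ_eq_one stepψ_nonneg
  stepψ_le_one)
open Summit.QuantumFields.YangMills.Cruxes.AtomicCalibrationR.GridPartition (gridBump gridCentre profile_sub_eq_zero
  sum_Icc_profile_eq_one)
open Summit.QuantumFields.YangMills.Cruxes.AtomicCalibrationR.TelescopingAssembly (tele)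
open Summit.QuantumFields.YangMills.Cruxes.AtomicCalibrationR.GevreyBandBump (cut norm_iteratedFDeriv_bandBump_le_gevrey
  norm_iteratedFDeriv_farBump_le_gevrey)
open Summit.QuantumFields.YangMills.Cruxes.AtomicCalibrationR.MassInputs (bandPiece_eq_zero_of_lt_two)
open Summit.QuantumFields.YangMills.Cruxes.AtomicCalibrationR.GevreyLevelMass (level_mass_factorial)
open Summit.QuantumFields.YangMills.Cruxes.AtomicCalibrationR.GevreyFarLevelMass (far_level_mass_factorial)
open Summit.QuantumFields.YangMills.Cruxes.AtomicCalibrationR.LevelConstants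
open Literature.MathematicalPhysics.QuantumLattice (schwartzNorm schwartzNorm_nonneg schwartzNorm_mono)
open Literature.MathematicalPhysics.AQFT (IsOffDiagonal)

namespace Summit.QuantumFields.YangMills.Cruxes.AtomicCalibrationR.LevelWeights

variable {n : ℕ}

/-- The generic cut-off of `GevreyBandBump` at the tree's step `stepψ` is `pairCut`. -/
theorem cut_stepψ (n k : ℕ) : cut stepψ n k = pairCut n k := rfl

/-- The piece of level `0` is the far piece, the piece of level `k+1` is the band piece (unfolding `tele`). -/
theorem tele_pairCut_zero (z : Fin n → EuclideanSpace ℝ (Fin 4)) : tele (fun j => pairCut n j z) 0 = pairCut n 0 z := rfl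

/-- See `tele_pairCut_zero`. -/
theorem tele_pairCut_succ (k : ℕ) (z : Fin n → EuclideanSpace ℝ (Fin 4)) :
    tele (fun j => pairCut n j z) (k + 1) = pairCut n (k + 1) z - pairCut n k z := rfl

/-! ## Arithmetic skeletons

The two level estimates are chains of elementary monotonicity steps on long products.  To keep elaboration cheap they are proved
once on opaque real variables and instantiated in `level_weights`. -/

/-- Skeleton of the far-level estimate. -/
theorem far_skeleton {A p p' fac t t' u S S₁ S₂ m q B r : ℝ} {e N : ℕ}
    (hA : 0 ≤ A) (hp : 0 ≤ p) (hpp : p ≤ p') (hfac : 0 ≤ fac) (ht : 0 ≤ t) (htt : t ≤ t') (hu : 0 ≤ u)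
    (hS : 0 ≤ S) (hSS : S ≤ S₁) (hS₁ : S₁ ≤ S₂) (hm : 0 ≤ m) (hmq : m ≤ q)
    (hB : A * p' ^ e * (fac * (t' * u * q ^ N)) ≤ B) (hr : r = 1) :
    A * p ^ e * (fac * (t * u * S * m ^ N)) ≤ B * r * S₂ := by
  have hS₁0 : 0 ≤ S₁ := hS.trans hSS
  have hq : 0 ≤ q := hm.trans hmq
  have ht' : 0 ≤ t' := ht.trans htt
  have hp' : 0 ≤ p' := hp.trans hpp
  have hB0 : 0 ≤ B := le_trans (by positivity) hB
  calc A * p ^ e * (fac * (t * u * S * m ^ N)) ≤ A * p' ^ e * (fac * (t' * u * S₁ * q ^ N)) := by gcongr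
    _ = A * p' ^ e * (fac * (t' * u * q ^ N)) * S₁ := by ring
    _ ≤ B * S₂ := mul_le_mul hB hS₁ hS₁0 hB0
    _ = B * r * S₂ := by rw [hr, mul_one]

/-- Skeleton of the band-level estimate. -/
theorem band_skeleton {a a' n₂ c c' p P G fac tk tk' f f' S S₂ q₀ Q g m r r' B : ℝ} {e N : ℕ}
    (ha : 0 ≤ a) (haa : a ≤ a') (hn₂ : 0 ≤ n₂) (hc : 0 ≤ c) (hcc : c ≤ c') (hp : 0 ≤ p) (hpe : p ^ e ≤ P * G)
    (hP : 0 ≤ P) (hG : 0 ≤ G) (hfac : 0 ≤ fac) (htk : 0 ≤ tk) (htt : tk ≤ tk') (hf : 0 ≤ f) (hff : f ≤ f')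
    (hS : 0 ≤ S) (hSS : S ≤ S₂) (hq₀ : 0 ≤ q₀) (hqQ : q₀ ≤ Q) (hg : 0 ≤ g) (hm : 0 ≤ m) (hmQ : m ≤ Q)
    (hgain : G * g ≤ r) (hr : r = 2 * r') (hB : 2 * (a' * (n₂ * c' ^ 4 * P) * (fac * (tk' * f' * Q ^ N * Q ^ N))) ≤ B) :
    a * (n₂ * c ^ 4 * p ^ e) * (fac * (tk * f * S * q₀ ^ N * g * m ^ N)) ≤ B * r' * S₂ := by
  have hQ : 0 ≤ Q := hm.trans hmQ
  have hr0 : 0 ≤ r := le_trans (mul_nonneg hG hg) hgain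
  have hr'0 : 0 ≤ r' := by rw [hr] at hr0; linarith
  have hS₂ : 0 ≤ S₂ := hS.trans hSS
  have ha' : 0 ≤ a' := ha.trans haa
  have hc' : 0 ≤ c' := hc.trans hcc
  have htk' : 0 ≤ tk' := htk.trans htt
  have hf' : 0 ≤ f' := hf.trans hff
  have hB0 : 0 ≤ B := le_trans (by positivity) hB
  calc a * (n₂ * c ^ 4 * p ^ e) * (fac * (tk * f * S * q₀ ^ N * g * m ^ N))
      ≤ a' * (n₂ * c' ^ 4 * (P * G)) * (fac * (tk' * f' * S₂ * Q ^ N * g * Q ^ N)) := by gcongr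
    _ = a' * (n₂ * c' ^ 4 * P) * (fac * (tk' * f' * Q ^ N * Q ^ N)) * (G * g) * S₂ := by ring
    _ ≤ a' * (n₂ * c' ^ 4 * P) * (fac * (tk' * f' * Q ^ N * Q ^ N)) * r * S₂ := by gcongr
    _ = 2 * (a' * (n₂ * c' ^ 4 * P) * (fac * (tk' * f' * Q ^ N * Q ^ N))) * r' * S₂ := by rw [hr]; ring
    _ ≤ B * r' * S₂ := by gcongr

/-! ## The level weights -/

/-- **The Whitney weights of every level** (clauses (v)–(vi) of `WhitneyPkg`, per level, uniformly in the level).  See the module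
docstring. [folklore] -/
theorem level_weights {Λ : ℝ} (hΛ : 1 ≤ Λ) (N' s : ℕ)
    {φ : ℝ → ℝ} (hφ : ContDiff ℝ ∞ φ) (hφs : tsupport φ ⊆ Icc (-1 : ℝ) 1) (hφ0 : ∀ t, 0 ≤ φ t)
    (hφ1 : ∀ t, ∑' c : ℤ, φ (t - c) = 1) {C₀ C₁ C₀' C₁' : ℝ} (hC₀ : 1 ≤ C₀) (hC₁ : 1 ≤ C₁) (hC₀' : 1 ≤ C₀') (hC₁' : 1 ≤ C₁')
    (hDφ : ∀ (j : ℕ) (t : ℝ), ‖iteratedFDeriv ℝ j φ t‖ ≤ C₀ * C₁ ^ j * ((Nat.factorial j : ℕ) : ℝ) ^ s)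
    (hDψ : ∀ (i : ℕ) (t : ℝ), ‖iteratedFDeriv ℝ i stepψ t‖ ≤ C₀' * C₁' ^ i * ((Nat.factorial i : ℕ) : ℝ) ^ s) :
    ∃ α C : ℝ, ∃ γ : ℕ, 0 ≤ α ∧ 0 ≤ C ∧ ∀ n : ℕ, 1 ≤ n →
      ∀ (F : SchwartzMap (Fin n → EuclideanSpace ℝ (Fin 4)) ℂ), IsOffDiagonal F →
      ∀ (G : (Fin n → EuclideanSpace ℝ (Fin 4)) → ℝ), ContDiff ℝ ∞ G →
        (∀ (j : ℕ) (w : Fin n → EuclideanSpace ℝ (Fin 4)), ‖iteratedFDeriv ℝ j G w‖ ≤ ‖iteratedFDeriv ℝ j F w‖) →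
      ∀ k : ℕ, ∃ M : (Fin n × Fin 4 → ℤ) → ℝ, (∀ c, 0 ≤ M c) ∧ Summable M ∧
        ∑' c, M c ≤ α * C ^ n * (n.factorial : ℝ) ^ γ * (2 : ℝ)⁻¹ ^ k * schwartzNorm ((N' + 6) * n) F ∧
        ∀ (c : Fin n × Fin 4 → ℤ) (m : ℕ), m ≤ N' * n → ∀ z : Fin n → EuclideanSpace ℝ (Fin 4),
          ‖iteratedFDeriv ℝ m (fun w => G w * (tele (fun j => pairCut n j w) k *
              gridBump φ n ((2 : ℝ)⁻¹ ^ k / (8 * (Λ + 1))) c w)) z‖ ≤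
            M c / (2 * ((2 : ℝ)⁻¹ ^ k / (8 * (Λ + 1)))) ^ m := by
  have hΛ0 : 0 < Λ := by linarith
  have hC₀0 : 0 ≤ C₀ := by linarith
  have hC₁0 : 0 ≤ C₁ := by linarith
  have hC₀'0 : 0 ≤ C₀' := by linarith
  have hC₁'0 : 0 ≤ C₁' := by linarith
  have hL0 : 0 ≤ Λ + 1 := by linarith
  have hL1 : 1 ≤ Λ + 1 := by linarith
  obtain ⟨α, C, γ, hα, hC, hT⟩ := adm_levelConst Λ N' s hC₀0 hC₁0 hC₀'0 hC₁'0 hL0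
  refine ⟨α, C, γ, hα, hC, fun n hn F hF G hG hGF k => ?_⟩
  -- `‖φ‖ ≤ 1` (as in `BandBump.profile_abs_le_one`) and the step thresholds
  have hφn : ∀ t : ℝ, ‖φ t‖ ≤ 1 := by
    intro t
    rw [Real.norm_eq_abs, abs_of_nonneg (hφ0 t)]
    by_cases hmem : (0 : ℤ) ∈ Finset.Icc (⌊t⌋ - 1) (⌈t⌉ + 1)
    · have hle : φ (t - ((0 : ℤ) : ℝ)) ≤ ∑ j ∈ Finset.Icc (⌊t⌋ - 1) (⌈t⌉ + 1), φ (t - j) :=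
        Finset.single_le_sum (f := fun j : ℤ => φ (t - j)) (fun j _ => hφ0 _) hmem
      rw [sum_Icc_profile_eq_one hφs hφ1 t, Int.cast_zero, sub_zero] at hle
      exact hle
    · have h0 := profile_sub_eq_zero hφs t hmem
      rw [Int.cast_zero, sub_zero] at h0
      rw [h0]; exact zero_le_one
  have hψ4 : ∀ x : ℝ, 4 ≤ x → stepψ x = 1 := fun x hx => stepψ_eq_one hx
  -- small facts about `n`, the Schwartz index `K = N'n + 4n + 2 ≤ (N'+6) n` and the polynomial `Q(n)`
  have hn0 : (0 : ℝ) ≤ n := Nat.cast_nonneg n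
  have hQ1 : (1 : ℝ) ≤ (1 + 32 * C₀' * C₁' * (n : ℝ) ^ 2 + 64 * C₀ * C₁ * (Λ + 1) * n) := by
    have h1 : 0 ≤ 32 * C₀' * C₁' * (n : ℝ) ^ 2 := by positivity
    have h2 : 0 ≤ 64 * C₀ * C₁ * (Λ + 1) * n := by positivity
    linarith
  have hQ0 : (0 : ℝ) ≤ (1 + 32 * C₀' * C₁' * (n : ℝ) ^ 2 + 64 * C₀ * C₁ * (Λ + 1) * n) := zero_le_one.trans hQ1
  have hKN : N' * n + 4 * n + 2 ≤ (N' + 6) * n := by nlinarith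
  have hSN : 0 ≤ schwartzNorm ((N' + 6) * n) F := schwartzNorm_nonneg _ _
  have hfac0 : (0 : ℝ) ≤ (((N' * n).factorial : ℕ) : ℝ) ^ (s + 1) := by positivity
  have hfar0 : (0 : ℝ) ≤ 2 ^ (4 * n + 1) * (24 * (Λ + 1)) ^ (4 * n) * ((((N' * n).factorial : ℕ) : ℝ) ^ (s + 1) * (2 ^ (N' * n + 4 * n + 2) * 2 ^ (4 * n + 2) * (1 + 32 * C₀' * C₁' * (n : ℝ) ^ 2 + 64 * C₀ * C₁ * (Λ + 1) * n) ^ (N' * n))) := by positivity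
  have hband0 : (0 : ℝ) ≤ 2 * (2 ^ (4 * n) * ((n : ℝ) ^ 2 * (64 * (Λ + 1) + 11) ^ 4 * (48 * (Λ + 1)) ^ (4 * n)) * ((((N' * n).factorial : ℕ) : ℝ) ^ (s + 1) * (2 ^ (N' * n + 4 * n + 2) * 4 ^ (4 * n) * (1 + 32 * C₀' * C₁' * (n : ℝ) ^ 2 + 64 * C₀ * C₁ * (Λ + 1) * n) ^ (N' * n) * (1 + 32 * C₀' * C₁' * (n : ℝ) ^ 2 + 64 * C₀ * C₁ * (Λ + 1) * n) ^ (N' * n)))) := by positivity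
  -- the two level constants are individually below `α Cⁿ (n!)^γ`
  have hTn := hT n hn
  have hfar_le : 2 ^ (4 * n + 1) * (24 * (Λ + 1)) ^ (4 * n) * ((((N' * n).factorial : ℕ) : ℝ) ^ (s + 1) * (2 ^ (N' * n + 4 * n + 2) * 2 ^ (4 * n + 2) * (1 + 32 * C₀' * C₁' * (n : ℝ) ^ 2 + 64 * C₀ * C₁ * (Λ + 1) * n) ^ (N' * n))) ≤ α * C ^ n * (n.factorial : ℝ) ^ γ := le_trans (le_add_of_nonneg_right hband0) hTn
  have hband_le : 2 * (2 ^ (4 * n) * ((n : ℝ) ^ 2 * (64 * (Λ + 1) + 11) ^ 4 * (48 * (Λ + 1)) ^ (4 * n)) * ((((N' * n).factorial : ℕ) : ℝ) ^ (s + 1) * (2 ^ (N' * n + 4 * n + 2) * 4 ^ (4 * n) * (1 + 32 * C₀' * C₁' * (n : ℝ) ^ 2 + 64 * C₀ * C₁ * (Λ + 1) * n) ^ (N' * n) * (1 + 32 * C₀' * C₁' * (n : ℝ) ^ 2 + 64 * C₀ * C₁ * (Λ + 1) * n) ^ (N' * n)))) ≤ α * C ^ n * (n.factorial : ℝ) ^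 γ := le_trans (le_add_of_nonneg_left hfar0) hTn
  clear hTn hT
  cases k with
  | zero =>
    -- ### the far level (mesh `h₀ = 2⁰/(8(Λ+1))`, rate `R₀`)
    clear hband_le hband0
    have e3 := three_div_mesh hΛ 0
    have e4 := two_mesh_mul_farRate_le (C₀ := C₀) (C₁ := C₁) (C₀' := C₀') (C₁' := C₁') hΛ hC₀0 hC₁0 hC₀'0 hC₁'0 n
    have hh0 := mesh_pos hΛ 0
    have hh2 := two_mesh_le_half hΛ 0
    have hRpos := farRate_pos (C₀ := C₀) (C₁ := C₁) (C₀' := C₀') (C₁' := C₁') hΛ hC₀ hC₁ hC₀' hC₁' hn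
    -- the ingredients of the far skeleton
    have hA : (0 : ℝ) ≤ 2 ^ (4 * n + 1) := by positivity
    have hp : (0 : ℝ) ≤ 3 / ((2 : ℝ)⁻¹ ^ 0 / (8 * (Λ + 1))) := div_nonneg zero_le_three hh0.le
    have hpp : (3 : ℝ) / ((2 : ℝ)⁻¹ ^ 0 / (8 * (Λ + 1))) ≤ 24 * (Λ + 1) := by rw [e3, pow_zero, mul_one]
    have hmaxK : max (4 * n + 2) (N' * n) ≤ N' * n + 4 * n + 2 := by omega
    have ht : (0 : ℝ) ≤ 2 ^ max (4 * n + 2) (N' * n) := by positivity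
    have htt : (2 : ℝ) ^ max (4 * n + 2) (N' * n) ≤ 2 ^ (N' * n + 4 * n + 2) := pow_le_pow_right₀ (by norm_num) hmaxK
    have hu : (0 : ℝ) ≤ 2 ^ (4 * n + 2) := by positivity
    have hS : 0 ≤ schwartzNorm (max (4 * n + 2) (N' * n)) F := schwartzNorm_nonneg _ _
    have hSS : schwartzNorm (max (4 * n + 2) (N' * n)) F ≤ schwartzNorm (N' * n + 4 * n + 2) F := schwartzNorm_mono hmaxK F
    have hS₁ : schwartzNorm (N' * n + 4 * n + 2) F ≤ schwartzNorm ((N' + 6) * n) F := schwartzNorm_mono hKN F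
    have hm : 0 ≤ max 1 (2 * ((2 : ℝ)⁻¹ ^ 0 / (8 * (Λ + 1))) * (1 + ((n : ℝ) ^ 2 * (8 * C₀' * C₁') + 4 * n * (C₀ * C₁ / ((2 : ℝ)⁻¹ ^ 0 / (8 * (Λ + 1))))))) := le_trans zero_le_one (le_max_left _ _)
    have hmq : max 1 (2 * ((2 : ℝ)⁻¹ ^ 0 / (8 * (Λ + 1))) * (1 + ((n : ℝ) ^ 2 * (8 * C₀' * C₁') + 4 * n * (C₀ * C₁ / ((2 : ℝ)⁻¹ ^ 0 / (8 * (Λ + 1))))))) ≤ (1 + 32 * C₀' * C₁' * (n : ℝ) ^ 2 + 64 * C₀ * C₁ * (Λ + 1) * n) := by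
      refine max_le hQ1 (e4.trans ?_)
      exact le_rfl
    have hr : (2 : ℝ)⁻¹ ^ 0 = 1 := pow_zero _
    -- the rates of the far bumps and the far level mass
    have hb : ∀ (c : Fin n × Fin 4 → ℤ) (z : Fin n → EuclideanSpace ℝ (Fin 4)) (i : ℕ), i ≤ N' * n →
        ‖iteratedFDeriv ℝ i (fun w => pairCut n 0 w * gridBump φ n ((2 : ℝ)⁻¹ ^ 0 / (8 * (Λ + 1))) c w) z‖ ≤
          ((Nat.factorial i : ℕ) : ℝ) ^ (s + 1) * ((n : ℝ) ^ 2 * (8 * C₀' * C₁') + 4 * n * (C₀ * C₁ / ((2 : ℝ)⁻¹ ^ 0 / (8 * (Λ + 1))))) ^ i := by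
      intro c z i _
      have := norm_iteratedFDeriv_farBump_le_gevrey hφ hφn contDiff_stepψ hψ4 stepψ_nonneg stepψ_le_one hC₀ hC₁0 hC₀' hC₁'
        hDφ hDψ hh0 c i z
      rw [cut_stepψ] at this
      exact this
    obtain ⟨M, hM0, hMs, hMle, hMv⟩ := far_level_mass_factorial F hG hGF hφ hφs hh0 hh2 (N' * n) (s + 1) hRpos hb
    refine ⟨M, hM0, hMs, hMle.trans (far_skeleton hA hp hpp hfac0 ht htt hu hS hSS hS₁ hm hmq hfar_le hr), ?_⟩
    -- clause (v) at the far level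
    intro c m' hm' z
    simp only [tele_pairCut_zero]
    exact hMv c m' hm' z
  | succ k =>
    -- ### the band level `k+1` (mesh `h_{k+1} = 2^{-(k+1)}/(8(Λ+1))`, rate `R_{k+1}`)
    clear hfar_le hfar0
    by_cases hn2 : n < 2
    · -- `n = 1`: no pairs, every band piece vanishes
      have hbound0 : 0 ≤ α * C ^ n * (n.factorial : ℝ) ^ γ * (2 : ℝ)⁻¹ ^ (k + 1) * schwartzNorm ((N' + 6) * n) F := by
        positivity
      refine ⟨fun _ => 0, fun _ => le_rfl, summable_zero, by rw [tsum_zero]; exact hbound0, fun c m _ z => ?_⟩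
      have hzero : (fun w => G w * (tele (fun j => pairCut n j w) (k + 1) *
          gridBump φ n ((2 : ℝ)⁻¹ ^ (k + 1) / (8 * (Λ + 1))) c w)) = fun _ => (0 : ℝ) := by
        funext w; rw [tele_pairCut_succ, bandPiece_eq_zero_of_lt_two hn2, mul_zero]
      rw [hzero, iteratedFDeriv_fun_zero, Pi.zero_apply, norm_zero, zero_div]
    push Not at hn2
    have e1 := inv_pow_mul_bandRate (C₀ := C₀) (C₁ := C₁) (C₀' := C₀') (C₁' := C₁') hΛ n k
    have e2 := two_mesh_mul_bandRate_le (C₀ := C₀) (C₁ := C₁) (C₀' := C₀') (C₁' := C₁') hΛ hC₀0 hC₁0 hC₀'0 hC₁'0 n k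
    have e3 := three_div_mesh hΛ (k + 1)
    have hRge := pow_le_bandRate (C₀ := C₀) (C₁ := C₁) (C₀' := C₀') (C₁' := C₁') hΛ hC₀ hC₁ hC₀' hC₁' hn k
    have hh0 := mesh_pos hΛ (k + 1)
    have hh2 := two_mesh_le_half hΛ (k + 1)
    have hNK : N' * n < N' * n + 4 * n + 2 := by omega
    -- the ingredients of the band skeleton
    have ha : (0 : ℝ) ≤ 2 ^ (4 * n - 4 + 1) := by positivity
    have haa : (2 : ℝ) ^ (4 * n - 4 + 1) ≤ 2 ^ (4 * n) := pow_le_pow_right₀ (by norm_num) (by omega)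
    have hn₂ : (0 : ℝ) ≤ (n : ℝ) ^ 2 := by positivity
    have hc : (0 : ℝ) ≤ 2 * (⌈(2 * (2 : ℝ)⁻¹ ^ k + 4 * ((2 : ℝ)⁻¹ ^ (k + 1) / (8 * (Λ + 1)))) / ((2 : ℝ)⁻¹ ^ (k + 1) / (8 * (Λ + 1)))⌉₊ : ℝ) + 1 := by positivity
    have hcc := ceil_ratio_le hΛ k
    have hp : (0 : ℝ) ≤ 3 / ((2 : ℝ)⁻¹ ^ (k + 1) / (8 * (Λ + 1))) := div_nonneg zero_le_three hh0.le
    have hpe : ((3 : ℝ) / ((2 : ℝ)⁻¹ ^ (k + 1) / (8 * (Λ + 1)))) ^ (4 * n - 4) ≤ (48 * (Λ + 1)) ^ (4 * n) * ((2 : ℝ) ^ k) ^ (4 * n - 4) := by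
      have h3 : (3 : ℝ) / ((2 : ℝ)⁻¹ ^ (k + 1) / (8 * (Λ + 1))) = 48 * (Λ + 1) * 2 ^ k := by rw [e3, pow_succ]; ring
      rw [h3, mul_pow]
      exact mul_le_mul_of_nonneg_right
        (pow_le_pow_right₀ (hL1.trans (le_mul_of_one_le_left hL0 (by norm_num))) (by omega)) (by positivity)
    have hP : (0 : ℝ) ≤ (48 * (Λ + 1)) ^ (4 * n) := by positivity
    have hG' : (0 : ℝ) ≤ ((2 : ℝ) ^ k) ^ (4 * n - 4) := by positivity
    have htk : (0 : ℝ) ≤ 2 ^ max (4 * n - 4 + 2) (N' * n + 4 * n + 2) := by positivity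
    have htt : (2 : ℝ) ^ max (4 * n - 4 + 2) (N' * n + 4 * n + 2) ≤ 2 ^ (N' * n + 4 * n + 2) :=
      pow_le_pow_right₀ (by norm_num) (max_le (by omega) le_rfl)
    have hf : (0 : ℝ) ≤ 4 ^ (4 * n - 4 + 2) := by positivity
    have hff : (4 : ℝ) ^ (4 * n - 4 + 2) ≤ 4 ^ (4 * n) := pow_le_pow_right₀ (by norm_num) (by omega)
    have hS : 0 ≤ schwartzNorm (max (4 * n - 4 + 2) (N' * n + 4 * n + 2)) F := schwartzNorm_nonneg _ _
    have hSS : schwartzNorm (max (4 * n - 4 + 2) (N' * n + 4 * n + 2)) F ≤ schwartzNorm ((N' + 6) * n) F :=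
      schwartzNorm_mono ((max_le (by omega) le_rfl).trans hKN) F
    have hq₀ : (0 : ℝ) ≤ 1 + (2 : ℝ)⁻¹ ^ k * (2 * ((n : ℝ) ^ 2 * (8 * C₀' * C₁' * (2 : ℝ) ^ (k + 1))) + 4 * n * (C₀ * C₁ / ((2 : ℝ)⁻¹ ^ (k + 1) / (8 * (Λ + 1))))) := by rw [e1]; positivity
    have hqQ : 1 + (2 : ℝ)⁻¹ ^ k * (2 * ((n : ℝ) ^ 2 * (8 * C₀' * C₁' * (2 : ℝ) ^ (k + 1))) + 4 * n * (C₀ * C₁ / ((2 : ℝ)⁻¹ ^ (k + 1) / (8 * (Λ + 1))))) ≤ (1 + 32 * C₀' * C₁' * (n : ℝ) ^ 2 + 64 * C₀ * C₁ * (Λ + 1) * n) := by rw [e1, ← add_assoc]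
    have hg : (0 : ℝ) ≤ ((2 : ℝ)⁻¹ ^ k) ^ (N' * n + 4 * n + 2) := by positivity
    have hm : 0 ≤ max 1 (2 * ((2 : ℝ)⁻¹ ^ (k + 1) / (8 * (Λ + 1))) * (2 * ((n : ℝ) ^ 2 * (8 * C₀' * C₁' * (2 : ℝ) ^ (k + 1))) + 4 * n * (C₀ * C₁ / ((2 : ℝ)⁻¹ ^ (k + 1) / (8 * (Λ + 1)))))) := le_trans zero_le_one (le_max_left _ _)
    have hmQ : max 1 (2 * ((2 : ℝ)⁻¹ ^ (k + 1) / (8 * (Λ + 1))) * (2 * ((n : ℝ) ^ 2 * (8 * C₀' * C₁' * (2 : ℝ) ^ (k + 1))) + 4 * n * (C₀ * C₁ / ((2 : ℝ)⁻¹ ^ (k + 1) / (8 * (Λ + 1)))))) ≤ (1 + 32 * C₀' * C₁' * (n : ℝ) ^ 2 + 64 * C₀ * C₁ * (Λ + 1) * n) := by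
      refine max_le hQ1 (e2.trans ?_)
      rw [add_assoc]
      exact le_add_of_nonneg_left zero_le_one
    have hgain : ((2 : ℝ) ^ k) ^ (4 * n - 4) * ((2 : ℝ)⁻¹ ^ k) ^ (N' * n + 4 * n + 2) ≤ (2 : ℝ)⁻¹ ^ k :=
      dyadic_gain_le (by omega) k
    have hr : (2 : ℝ)⁻¹ ^ k = 2 * (2 : ℝ)⁻¹ ^ (k + 1) := by
      rw [pow_succ, mul_comm (2 : ℝ), mul_assoc, inv_mul_cancel₀ (by norm_num : (2 : ℝ) ≠ 0), mul_one]
    -- the rates of the band bumps and the band level mass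
    have hb : ∀ (c : Fin n × Fin 4 → ℤ) (z : Fin n → EuclideanSpace ℝ (Fin 4)) (i : ℕ), i ≤ N' * n →
        ‖iteratedFDeriv ℝ i (fun w => (pairCut n (k + 1) w - pairCut n k w) * gridBump φ n ((2 : ℝ)⁻¹ ^ (k + 1) / (8 * (Λ + 1))) c w) z‖ ≤
          ((Nat.factorial i : ℕ) : ℝ) ^ (s + 1) * (2 * ((n : ℝ) ^ 2 * (8 * C₀' * C₁' * (2 : ℝ) ^ (k + 1))) + 4 * n * (C₀ * C₁ / ((2 : ℝ)⁻¹ ^ (k + 1) / (8 * (Λ + 1))))) ^ i := by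
      intro c z i _
      have := norm_iteratedFDeriv_bandBump_le_gevrey hφ hφn contDiff_stepψ hψ4 stepψ_nonneg stepψ_le_one hC₀ hC₁0 hC₀' hC₁'
        hDφ hDψ hn hh0 k c i z
      rw [cut_stepψ, cut_stepψ] at this
      exact this
    obtain ⟨M, hM0, hMs, hMle, hMv⟩ :=
      level_mass_factorial hn2 F hF hG hGF hφ hφs hh0 hh2 k (K := N' * n + 4 * n + 2) hNK (s + 1) hRge hb
    refine ⟨M, hM0, hMs, hMle.trans (band_skeleton ha haa hn₂ hc hcc hp hpe hP hG' hfac0 htk htt hf hff hS hSS hq₀ hqQ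
      hg hm hmQ hgain hr hband_le), ?_⟩
    -- clause (v) at the band level
    intro c m' hm' z
    simp only [tele_pairCut_succ]
    exact hMv c m' hm' z

end Summit.QuantumFields.YangMills.Cruxes.AtomicCalibrationR.LevelWeights

end
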